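import Mathlib

/-!
# `SubtorusCovering`, line `pair-sacrifice`: stub `stub_torusExtension`

Crux `stmt-ValiantsHypothesis-16134`
(`Summit.ValiantsHypothesis.ValiantsHypothesis.Theses.FreeSubtorus.SubtorusCovering`), line
`pair-sacrifice`, registered stub 3 (`Stmt.stub_torusExtension`).

**Statement.** Let `Λ : Fin r → (Fin (n' + s) ⊕ Fin (n' + s)) → ℤ` and `N > 0`, and write
`v_j = Λ(·)(inl (natAdd n' j)) - Λ(·)(inr (natAdd n' j))` (`j < s`) for the sacrificed differences.
If `N` times every free column of `Λ` (the columns `inl (castAdd s k)` and `inr (castAdd s l)`,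
`k, l < n'`) is an integer combination of the `v_j`, then for all `d', e' : Fin n' → ℂˣ` there are
`d, e : Fin (n' + s) → ℂˣ` in the torus
`T_Λ = {∏_k d_k ^ Λ_i(inl k) * ∏_l e_l ^ Λ_i(inr l) = 1 ∀ i}` with `d (castAdd s k) = d' k ^ N`,
`e (castAdd s l) = e' l ^ N` and `d (natAdd n' j) * e (natAdd n' j) = 1`.

**Proof.** Choose the coefficients `ar k`, `ac l : Fin s → ℤ` of the free columns, put
`A j = (∏ k, d' k ^ ar k j) * (∏ l, e' l ^ ac l j)` and take
`d = Fin.append (d' ^ N) (A⁻¹)`, `e = Fin.append (e' ^ N) A`.  In relation `i` the free part is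
`∏ j, A j ^ v_j(i)` (push `N` into the exponent, expand the sums, swap the products) and the
sacrificed part is `∏ j, A j ^ (-v_j(i))`, so the product is `1`; the other three properties are
`Fin.append_left`, `Fin.append_right` and `inv_mul_cancel`.
-/

open Finset

-- the mandated summit-side namespace repeats a component by design (single-problem summit)
set_option linter.dupNamespace false

namespace Summit.ValiantsHypothesis.ValiantsHypothesis.Theorems.FreeSubtorusSubtorusCovering

/-- `a ^ (∑ i ∈ s, f i) = ∏ i ∈ s, a ^ f i` for integer exponents in a commutative group.
[folklore] -/
theorem stub_torusExtension_zpow_sum {G ι : Type*} [CommGroup G] (a : G) (s : Finset ι)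
    (f : ι → ℤ) : a ^ (∑ i ∈ s, f i) = ∏ i ∈ s, a ^ f i := by
  induction s using Finset.cons_induction with
  | empty => simp
  | cons i s hi ih => rw [Finset.sum_cons, Finset.prod_cons, zpow_add, ih]

/-- The free part of a relation: if `N * c k = ∑ j, a k j * (p j - q j)` for every `k`, then
`∏ k, (x k ^ N) ^ c k = ∏ j, (∏ k, x k ^ a k j) ^ (p j - q j)`. [folklore] -/
theorem stub_torusExtension_free {G : Type*} [CommGroup G] {n' s : ℕ} (N : ℕ) (x : Fin n' → G)
    (c : Fin n' → ℤ) (a : Fin n' → Fin s → ℤ) (p q : Fin s → ℤ)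
    (h : ∀ k, (N : ℤ) * c k = ∑ j, a k j * (p j - q j)) :
    ∏ k, (x k ^ N) ^ c k = ∏ j, (∏ k, x k ^ a k j) ^ (p j - q j) := by
  calc ∏ k, (x k ^ N) ^ c k = ∏ k, x k ^ ((N : ℤ) * c k) := by
        refine Finset.prod_congr rfl fun k _ => ?_
        rw [zpow_mul, zpow_natCast]
    _ = ∏ k, ∏ j, (x k ^ a k j) ^ (p j - q j) := by
        refine Finset.prod_congr rfl fun k _ => ?_
        rw [h k, stub_torusExtension_zpow_sum]
        refine Finset.prod_congr rfl fun j _ => ?_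
        rw [zpow_mul]
    _ = ∏ j, (∏ k, x k ^ a k j) ^ (p j - q j) := by
        rw [Finset.prod_comm]
        refine Finset.prod_congr rfl fun j _ => ?_
        rw [Finset.prod_zpow]

/-- The relation of the extended torus element in abstract form: with
`A j = (∏ k, x k ^ a k j) * (∏ l, y l ^ b l j)`, the free parts `∏ k, (x k ^ N) ^ cx k` and
`∏ l, (y l ^ N) ^ cy l` multiply to `∏ j, A j ^ (p j - q j)`, which the sacrificed part
`∏ j, (A j)⁻¹ ^ p j * ∏ j, A j ^ q j` cancels. [folklore] -/
theorem stub_torusExtension_relation {G : Type*} [CommGroup G] {n' s : ℕ} (N : ℕ)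
    (x y : Fin n' → G) (cx cy : Fin n' → ℤ) (p q : Fin s → ℤ) (a b : Fin n' → Fin s → ℤ)
    (hx : ∀ k, (N : ℤ) * cx k = ∑ j, a k j * (p j - q j))
    (hy : ∀ l, (N : ℤ) * cy l = ∑ j, b l j * (p j - q j))
    (A : Fin s → G) (hA : ∀ j, A j = (∏ k, x k ^ a k j) * (∏ l, y l ^ b l j)) :
    (∏ k, (x k ^ N) ^ cx k) * (∏ j, (A j)⁻¹ ^ p j) *
      ((∏ l, (y l ^ N) ^ cy l) * (∏ j, A j ^ q j)) = 1 := by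
  rw [stub_torusExtension_free N x cx a p q hx, stub_torusExtension_free N y cy b p q hy,
    mul_mul_mul_comm, ← Finset.prod_mul_distrib, ← Finset.prod_mul_distrib,
    ← Finset.prod_mul_distrib]
  refine Finset.prod_eq_one fun j _ => ?_
  rw [← mul_zpow, ← hA]
  group

/-- **Registered stub 3 = `Stmt.stub_torusExtension`** of the line `pair-sacrifice`: `N`-th powers
of the free torus extend to `T_Λ` across the sacrificed diagonal pairs when `N` times every free
column of `Λ` is an integer combination of the sacrificed differences (explicit extension
`d = Fin.append (d' ^ N) A⁻¹`, `e = Fin.append (e' ^ N) A`; `zpow` algebra in `ℂˣ`). [folklore] -/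
theorem stub_torusExtension :
    ∀ (n' s r : ℕ) (Λ : Fin r → (Fin (n' + s) ⊕ Fin (n' + s)) → ℤ) (N : ℕ), 0 < N →
    (∀ k : Fin n', ∃ a : Fin s → ℤ, ∀ i,
      (N : ℤ) * Λ i (Sum.inl (Fin.castAdd s k)) =
        ∑ j, a j * (Λ i (Sum.inl (Fin.natAdd n' j)) - Λ i (Sum.inr (Fin.natAdd n' j)))) →
    (∀ l : Fin n', ∃ a : Fin s → ℤ, ∀ i,
      (N : ℤ) * Λ i (Sum.inr (Fin.castAdd s l)) =
        ∑ j, a j * (Λ i (Sum.inl (Fin.natAdd n' j)) - Λ i (Sum.inr (Fin.natAdd n' j)))) →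
    ∀ d' e' : Fin n' → ℂˣ, ∃ d e : Fin (n' + s) → ℂˣ,
      (∀ i, (∏ k, (d k) ^ (Λ i (Sum.inl k))) * (∏ l, (e l) ^ (Λ i (Sum.inr l))) = 1) ∧
      (∀ k, d (Fin.castAdd s k) = d' k ^ N) ∧
      (∀ l, e (Fin.castAdd s l) = e' l ^ N) ∧
      (∀ j, d (Fin.natAdd n' j) * e (Fin.natAdd n' j) = 1) := by
  intro n' s r Λ N _hN hrow hcol d' e'
  choose ar har using hrow
  choose ac hac using hcol
  obtain ⟨A, hA⟩ :
      ∃ A : Fin s → ℂˣ, ∀ j, A j = (∏ k, d' k ^ ar k j) * (∏ l, e' l ^ ac l j) :=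
    ⟨_, fun _ => rfl⟩
  refine ⟨Fin.append (fun k => d' k ^ N) (fun j => (A j)⁻¹),
    Fin.append (fun l => e' l ^ N) (fun j => A j), fun i => ?_, fun k => ?_, fun l => ?_,
    fun j => ?_⟩
  · rw [Fin.prod_univ_add, Fin.prod_univ_add]
    simp only [Fin.append_left, Fin.append_right]
    exact stub_torusExtension_relation N d' e' _ _ _ _ ar ac (fun k => har k i)
      (fun l => hac l i) A hA
  · simp only [Fin.append_left]
  · simp only [Fin.append_left]
  · simp only [Fin.append_right, inv_mul_cancel]

end Summit.ValiantsHypothesis.ValiantsHypothesis.Theorems.FreeSubtorusSubtorusCovering
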